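import Summits.ResolutionOfSingularities.ResolutionOfSingularities.Theorems.FrobeniusLadderFInjectiveMacaulayficationLoopGermMNonFullPlane
import Summits.ResolutionOfSingularities.ResolutionOfSingularities.Theorems.FrobeniusLadderFInjectiveMacaulayficationKLocCellKitOff
import Summits.ResolutionOfSingularities.ResolutionOfSingularities.Theorems.FrobeniusLadderFInjectiveMacaulayficationKLocCellOff
import Summits.ResolutionOfSingularities.ResolutionOfSingularities.Theorems.FrobeniusLadderFInjectiveMacaulayficationNonFullLoopFloorOneLocus
import Summits.ResolutionOfSingularities.ResolutionOfSingularities.Theorems.FrobeniusLadderFInjectiveMacaulayficationPConeFedderData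
import HarnessLib

/-!
# (O-3)⁺ ★★★ THE NON-FULL LOCUS OF THE SECOND LOOP GERM IS THE PLANE: a point of `U_M = Spec k[a,b,c,d,e]/(M)` is NON-FULL **iff** it lies on `V(ā, c̄, ē)`
# (`char k = 2`) — the first centre of idea-1's 2-round policy for `M` (whose `a`-chart is `U_L`, ✓ p645661) IS the non-FULL locus
# (crux `FInjectiveMacaulayfication` stmt-ResolutionOfSingularities-15315, chain w45a; res-L1-w45a-plan-1 g19 RULING R19.18 (iii) / R19.16 context; sequel of this seat's
# `…LoopGermMNonFullPlane` («⊇» half); twin of `…LoopGermLNonFullLocus`; seat res-L1-w45a-stub-3 g10)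

[OURS · L1 W4.5a] Support file (`--supports stmt-ResolutionOfSingularities-15315 --as helper`); replaces the role of NO printed item; NOT a statement of any
manuscript; def-free; UNCONDITIONAL; `CharP k 2` throughout. AI-written (AI review is weaker than expert review).

`X 0 = a`, `X 1 = b`, `X 2 = c`, `X 3 = d`, `X 4 = e`; `M = X4² + X0²X2X4 + X0X2² + X0²X2X3² + X0X1³X2²`, `A = k[X]/(M)`,
plane `𝔮 = (ā, c̄, ē) = Ideal.span ((fun j => mk (X j)) '' ↑({0, 2, 4} : Finset (Fin 5)))`.
* §1 `M_eq_evalL`; ★ `offPlane_clause` — `A` carries the CM + Frobenius-closed clause at every MAXIMAL ideal missing one of `ā, c̄, ē`: the p-basis split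
  `M = 1·e² + (ce)·a² + a·c² + c·a²d² + (ab)·b²c²` has the three OFF-cells `a² · ce`, `c² · a`, `e² · 1` (one `decide +kernel` over `KLocCellKit.checkKsOff` +
  res-L1-w45a-stub-5's `KLocCellOff.honQuot_of_kLocCells_off`);
* §2 ★★ `fullCl_localization_of_not_plane_le` / `fullCl_stalk_of_not_plane_le` — FULL at EVERY point `w` off the plane;
  ★★★ `not_fullCl_stalk_iff_plane_le : ∀ w, ¬ FullCl 2 𝒪_{U_M,w} ↔ (ā, c̄, ē) ≤ w` (+ localization twin): THE NON-FULL LOCUS OF `U_M` IS EXACTLY THE PLANE `V(a,c,e)`.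
[cite: Fedder1983, Prop. 1.7 and Thm. 1.12]
-/

-- single-problem summit: the doubled namespace component is forced
set_option linter.dupNamespace false

noncomputable section

open AlgebraicGeometry CategoryTheory Literature.AlgebraicGeometry.Resolution TopologicalSpace IsLocalRing MvPolynomial

namespace Summit.ResolutionOfSingularities.ResolutionOfSingularities.Theorems.FInjectiveMacaulayfication.LoopGermMNonFullPlane

open Summit.ResolutionOfSingularities.ResolutionOfSingularities.Theorems.FInjectiveMacaulayfication
open SliceableCentre

variable (k : Type) [Field k]

/-! ## §1 `U_M` is F-pure (and CM) off the plane: three OFF-cells -/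

/-- `M` is the value of its term list. [plumbing] -/
theorem M_eq_evalL : (X 4 ^ 2 + X 0 ^ 2 * X 2 * X 4 + X 0 * X 2 ^ 2 + X 0 ^ 2 * X 2 * X 3 ^ 2 + X 0 * X 1 ^ 3 * X 2 ^ 2 : MvPolynomial (Fin 5) k) = KLocCellKit.evalL k [((1 : ℤ), ![0, 0, 0, 0, 2]), ((1 : ℤ), ![2, 0, 1, 0, 1]), ((1 : ℤ), ![1, 0, 2, 0, 0]), ((1 : ℤ), ![2, 0, 1, 2, 0]), ((1 : ℤ), ![1, 3, 2, 0, 0])] := by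
  simp only [KLocCellKit.evalL, List.map_cons, List.map_nil, List.sum_cons, List.sum_nil, Int.cast_one, PConeFedderData.monomial_five]
  ring

set_option maxHeartbeats 800000 in
-- one kernel `decide` for the four off-cells + the off-cell engine
/-- ★ **`U_M` OFF THE PLANE**: `k[X]/(M)` satisfies the CM + Frobenius-closed clause at every maximal ideal missing one of `ā, c̄, ē` (`char k = 2`). The three
OFF-cells: `a², c², e²` are the split coefficients of the classes `ce, a, 1`, so `h² ∈ (split coefficients)` for `h = a, c, e`. NOT claimed at maximal
ideals containing the plane (false there: `LoopGermMNonFullPlane.not_fullCl_localization_of_plane_le`). [cite: Fedder1983, Prop. 1.7, Thm. 1.12] -/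
theorem offPlane_clause [CharP k 2] (f : MvPolynomial (Fin 5) k) (hf : f = X 4 ^ 2 + X 0 ^ 2 * X 2 * X 4 + X 0 * X 2 ^ 2 + X 0 ^ 2 * X 2 * X 3 ^ 2 + X 0 * X 1 ^ 3 * X 2 ^ 2)
    (Q' : Ideal (MvPolynomial (Fin 5) k ⧸ Ideal.span {f})) [Q'.IsMaximal]
    (hQ' : ∃ j ∈ ({0, 2, 4} : Finset (Fin 5)), Ideal.Quotient.mk (Ideal.span {f}) (X j) ∉ Q') :
    ∀ d : ℕ, ringKrullDim (Localization.AtPrime Q') = d → ∀ s : Fin d → Localization.AtPrime Q',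
      (Ideal.span (Set.range s)).radical.IsMaximal →
        RingTheory.Sequence.IsWeaklyRegular (Localization.AtPrime Q') (List.ofFn s) ∧
        ∀ y : Localization.AtPrime Q', (∃ n : ℕ, y ^ 2 ^ n ∈ Ideal.span
          ((fun z : Localization.AtPrime Q' => z ^ 2 ^ n) '' (Ideal.span (Set.range s) : Set (Localization.AtPrime Q')))) → y ∈ Ideal.span (Set.range s) := by
  classical
  haveI : Fact (Nat.Prime 2) := ⟨Nat.prime_two⟩
  have hL := M_eq_evalL k
  have hX' := not_X_dvd_M k f hf
  have hg0' : f ≠ 0 := (LoopGermMCharts.prime_M k f hf).ne_zero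
  have hf' : f = KLocCellKit.evalL k [((1 : ℤ), ![0, 0, 0, 0, 2]), ((1 : ℤ), ![2, 0, 1, 0, 1]), ((1 : ℤ), ![1, 0, 2, 0, 0]), ((1 : ℤ), ![2, 0, 1, 2, 0]), ((1 : ℤ), ![1, 3, 2, 0, 0])] :=
    hf.trans hL
  subst hf'
  have hcellsOff := KLocCellKit.offCells_of_check (K := k) 2
    [((1 : ℤ), ![0, 0, 0, 0, 2]), ((1 : ℤ), ![2, 0, 1, 0, 1]), ((1 : ℤ), ![1, 0, 2, 0, 0]), ((1 : ℤ), ![2, 0, 1, 2, 0]), ((1 : ℤ), ![1, 3, 2, 0, 0])]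
    [(∅ : Finset (Fin 5))]
    [[((1 : ℤ), (Pi.single 0 1 : Fin 5 → ℕ))], [((1 : ℤ), (Pi.single 2 1 : Fin 5 → ℕ))], [((1 : ℤ), (Pi.single 4 1 : Fin 5 → ℕ))]]
    [((∅ : Finset (Fin 5)), [(![0, 0, 1, 0, 1], [((1 : ℤ), ![0, 0, 0, 0, 0])])], (fun _ => []), [], [((1 : ℤ), (Pi.single 0 1 : Fin 5 → ℕ))], 2),
      ((∅ : Finset (Fin 5)), [(![1, 0, 0, 0, 0], [((1 : ℤ), ![0, 0, 0, 0, 0])])], (fun _ => []), [], [((1 : ℤ), (Pi.single 2 1 : Fin 5 → ℕ))], 2),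
      ((∅ : Finset (Fin 5)), [(![0, 0, 0, 0, 0], [((1 : ℤ), ![0, 0, 0, 0, 0])])], (fun _ => []), [], [((1 : ℤ), (Pi.single 4 1 : Fin 5 → ℕ))], 2)]
    (by decide +kernel) (by decide)
  have H := KLocCellOff.honQuot_of_kLocCells_off 2 k 5 (∅ : Finset (Fin 5)) (1 : Matrix (Fin 5) (Fin 5) ℕ)
    (KLocCellKit.evalL k [((1 : ℤ), ![0, 0, 0, 0, 2]), ((1 : ℤ), ![2, 0, 1, 0, 1]), ((1 : ℤ), ![1, 0, 2, 0, 0]), ((1 : ℤ), ![2, 0, 1, 2, 0]), ((1 : ℤ), ![1, 3, 2, 0, 0])])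
    hg0' hX' [] [(∅ : Finset (Fin 5))]
    (([[((1 : ℤ), (Pi.single 0 1 : Fin 5 → ℕ))], [((1 : ℤ), (Pi.single 2 1 : Fin 5 → ℕ))], [((1 : ℤ), (Pi.single 4 1 : Fin 5 → ℕ))]] : List (List (ℤ × (Fin 5 → ℕ)))).map (KLocCellKit.evalL k))
    (fun T _ => Or.inr ⟨∅, by simp, Finset.empty_subset T⟩) (by simp) hcellsOff Q' (by simp) ?_
  · exact H.2
  · obtain ⟨j, hj, hjQ⟩ := hQ'
    refine ⟨_, List.mem_map.mpr ⟨[((1 : ℤ), (Pi.single j 1 : Fin 5 → ℕ))], ?_, NonFullLoopFloorOne.evalL_X k j⟩, hjQ⟩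
    simp only [Finset.mem_insert, Finset.mem_singleton] at hj
    rcases hj with rfl | rfl | rfl <;> simp

/-! ## §2 ★★ FULL at every point off the plane (the «⊆» half), and the two-sided locus lemma -/

/-- ★★ **`FullCl 2 (A_P)` at EVERY prime `P ⊉ (ā, c̄, ē)`** (`char k = 2`): a maximal `Q' ⊇ P` missing the same generator exists (`A` is Jacobson), §1 gives
the clause at `Q'`, and the clause (with `IsDomain`) localizes from `Q'` to `P` (`ClauseOfMaximal.fiClause_atPrime_of_le`). [OURS · certificate; cite: Fedder1983, Thm. 1.12] -/
theorem fullCl_localization_of_not_plane_le [CharP k 2] (f : MvPolynomial (Fin 5) k) (hf : f = X 4 ^ 2 + X 0 ^ 2 * X 2 * X 4 + X 0 * X 2 ^ 2 + X 0 ^ 2 * X 2 * X 3 ^ 2 + X 0 * X 1 ^ 3 * X 2 ^ 2)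
    (P : Ideal (MvPolynomial (Fin 5) k ⧸ Ideal.span {f})) [P.IsPrime]
    (hP : ¬ Ideal.span ((fun j : Fin 5 => Ideal.Quotient.mk (Ideal.span {f}) (X j)) '' (({0, 2, 4} : Finset (Fin 5)) : Set (Fin 5))) ≤ P) :
    FullCl 2 (Localization.AtPrime P) := by
  haveI : Fact (Nat.Prime 2) := ⟨Nat.prime_two⟩
  haveI := (Ideal.span_singleton_prime (LoopGermMCharts.prime_M k f hf).ne_zero).mpr (LoopGermMCharts.prime_M k f hf)
  haveI : IsDomain (MvPolynomial (Fin 5) k ⧸ Ideal.span {f}) := Ideal.Quotient.isDomain _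
  haveI : CharP (MvPolynomial (Fin 5) k ⧸ Ideal.span {f}) 2 := charP_of_injective_algebraMap (algebraMap k _).injective 2
  -- a generator outside `P`
  have hex : ∃ j ∈ ({0, 2, 4} : Finset (Fin 5)), Ideal.Quotient.mk (Ideal.span {f}) (X j) ∉ P := by
    by_contra hcon
    push Not at hcon
    exact hP (Ideal.span_le.mpr (by rintro _ ⟨j, hj, rfl⟩; exact hcon j hj))
  obtain ⟨j, hj, hjP⟩ := hex
  -- Jacobson: a maximal ideal `Q' ⊇ P` missing the same generator
  have hJ : P.jacobson = P := IsJacobsonRing.out inferInstance (Ideal.IsPrime.isRadical ‹_›)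
  have hexQ : ∃ Q' : Ideal (MvPolynomial (Fin 5) k ⧸ Ideal.span {f}), Q'.IsMaximal ∧ P ≤ Q' ∧ Ideal.Quotient.mk (Ideal.span {f}) (X j) ∉ Q' := by
    by_contra hcon
    push Not at hcon
    apply hjP
    rw [← hJ, Ideal.jacobson, Ideal.mem_sInf]
    rintro Q ⟨hPQ, hQ⟩
    exact hcon Q hQ hPQ
  obtain ⟨Q', hQ'max, hPQ', hjQ'⟩ := hexQ
  exact ClauseOfMaximal.fiClause_atPrime_of_le 2 hPQ' ⟨inferInstance, offPlane_clause k f hf Q' ⟨j, hj, hjQ'⟩⟩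

/-- ★★ **THE «⊆» HALF** (stalk form): every point `w` of `U_M` with `¬ (ā, c̄, ē) ≤ w` is FULL (`char k = 2`). [OURS · certificate] -/
theorem fullCl_stalk_of_not_plane_le [CharP k 2] (f : MvPolynomial (Fin 5) k) (hf : f = X 4 ^ 2 + X 0 ^ 2 * X 2 * X 4 + X 0 * X 2 ^ 2 + X 0 ^ 2 * X 2 * X 3 ^ 2 + X 0 * X 1 ^ 3 * X 2 ^ 2)
    (w : Spec (.of (MvPolynomial (Fin 5) k ⧸ Ideal.span {f})))
    (hw : ¬ Ideal.span ((fun j : Fin 5 => Ideal.Quotient.mk (Ideal.span {f}) (X j)) '' (({0, 2, 4} : Finset (Fin 5)) : Set (Fin 5))) ≤ w.asIdeal) :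
    FullCl 2 ((Spec (.of (MvPolynomial (Fin 5) k ⧸ Ideal.span {f}))).presheaf.stalk w) :=
  WFixAtNonClosedDimTwo.fullCl_of_ringEquiv 2 (Spec.stalkIso (.of _) w).commRingCatIsoToRingEquiv.symm
    (fullCl_localization_of_not_plane_le k f hf w.asIdeal hw)

/-- ★★★ **THE NON-FULL LOCUS OF THE SECOND LOOP GERM IS THE PLANE, BOTH SIDES**: for `U_M = Spec k[X]/(M)`, `M = e² + a²ce + ac² + a²cd² + ab³c²`, `char k = 2`,
a point `w` is NON-FULL **iff** `(ā, c̄, ē) ≤ w`. [OURS · certificate; cite: Fedder1983, Prop. 1.7 and Thm. 1.12] -/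
theorem not_fullCl_stalk_iff_plane_le [CharP k 2] (f : MvPolynomial (Fin 5) k) (hf : f = X 4 ^ 2 + X 0 ^ 2 * X 2 * X 4 + X 0 * X 2 ^ 2 + X 0 ^ 2 * X 2 * X 3 ^ 2 + X 0 * X 1 ^ 3 * X 2 ^ 2) :
    ∀ w : Spec (.of (MvPolynomial (Fin 5) k ⧸ Ideal.span {f})),
      ¬ FullCl 2 ((Spec (.of (MvPolynomial (Fin 5) k ⧸ Ideal.span {f}))).presheaf.stalk w) ↔ Ideal.span ((fun j : Fin 5 => Ideal.Quotient.mk (Ideal.span {f}) (X j)) '' (({0, 2, 4} : Finset (Fin 5)) : Set (Fin 5))) ≤ w.asIdeal :=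
  fun w => ⟨fun h => by_contra fun hw => h (fullCl_stalk_of_not_plane_le k f hf w hw), fun hw => not_fullCl_stalk_of_plane_le k f hf w hw⟩

/-- Localization form: `¬ FullCl 2 (A_P) ↔ (ā, c̄, ē) ≤ P` for every prime `P` of `A = k[X]/(M)`. [OURS · certificate] -/
theorem not_fullCl_localization_iff_plane_le [CharP k 2] (f : MvPolynomial (Fin 5) k) (hf : f = X 4 ^ 2 + X 0 ^ 2 * X 2 * X 4 + X 0 * X 2 ^ 2 + X 0 ^ 2 * X 2 * X 3 ^ 2 + X 0 * X 1 ^ 3 * X 2 ^ 2)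
    (P : Ideal (MvPolynomial (Fin 5) k ⧸ Ideal.span {f})) [P.IsPrime] :
    ¬ FullCl 2 (Localization.AtPrime P) ↔ Ideal.span ((fun j : Fin 5 => Ideal.Quotient.mk (Ideal.span {f}) (X j)) '' (({0, 2, 4} : Finset (Fin 5)) : Set (Fin 5))) ≤ P :=
  ⟨fun h => by_contra fun hP => h (fullCl_localization_of_not_plane_le k f hf P hP), fun hP => not_fullCl_localization_of_plane_le k f hf P hP⟩

end Summit.ResolutionOfSingularities.ResolutionOfSingularities.Theorems.FInjectiveMacaulayfication.LoopGermMNonFullPlane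

end
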